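import Summits.CriticalPhenomena.PercolationContinuityZ3.Theorems.PercNearOneGluingNoHeavyLowerTailAntiBandLevelSCL

/-!
# `NoHeavyLowerTail` (crux stmt-CriticalPhenomena-4575), lane prim-ineq-gen-4 (gen 31): the single-coordinate lemma at every level, GROUND-FINSET form

Support file (`--supports stmt-CriticalPhenomena-4575`; memo `run/shared/lean/prim/prim-ineq-gen-4/FINDING-PRINCIPAL-AND-CROSS-SPERNER-g31.md` §1.4).
Pure finite combinatorics, no definitions, no `sorry`, standard axioms.

`AntiBandLevelSCL.choose_mul_card_level_mem_le` (same generation) is stated for up-sets of all subsets of a finite type.  The principal-filter theorem of the memo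
(`Cov(1_{↑z},1_B) ≥ 2·P(#x=m)·Cov_m(1_{↑z},1_B)`) is an induction along `z` that lives inside the subcubes `{x ⊇ z_t}`, i.e. inside `𝒫(t)` for a shrinking ground finset
`t`; this file restates the lemma for a family `B ⊆ 𝒫(t)` closed under adding points of `t`, with sections in `t.erase i` and pivotal edges counted in `𝒫(t)`
(`choose_mul_card_level_mem_le_ground`).  The proof is the Fintype proof verbatim with `univ` replaced by `t`, reusing the normalized-matching lemma
`card_level_mul_choose_le` and the section level counts of the first file.
-/

namespace Summit.CriticalPhenomena.PercolationContinuityZ3.Theorems.AntiBandLevelSCL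

open Finset

variable {α : Type*} [DecidableEq α]

/-- Sections inside a ground finset: the `i ∉ y` part of `B ⊆ 𝒫(t)` is closed under adding points of `t.erase i`. [folklore] -/
theorem sectionG_zero_insert (t : Finset α) (B : Finset (Finset α)) (hB : ∀ x ∈ B, ∀ a ∈ t, insert a x ∈ B) (i : α) :
    ∀ x ∈ B.filter (fun y => i ∉ y), ∀ a ∈ t.erase i, insert a x ∈ B.filter (fun y => i ∉ y) := by
  intro x hx a ha
  rw [mem_filter] at hx ⊢
  rw [mem_erase] at ha
  refine ⟨hB x hx.1 a ha.2, ?_⟩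
  rw [mem_insert]
  rintro (h | h)
  · exact ha.1 h.symm
  · exact hx.2 h

/-- Sections inside a ground finset: members of the `i ∉ y` part lie in `t.erase i`. [folklore] -/
theorem sectionG_zero_subset (t : Finset α) (B : Finset (Finset α)) (hBt : ∀ x ∈ B, x ⊆ t) (i : α) :
    ∀ x ∈ B.filter (fun y => i ∉ y), x ⊆ t.erase i := by
  intro x hx b hb
  rw [mem_erase]
  exact ⟨fun h => (mem_filter.1 hx).2 (h ▸ hb), hBt x (mem_filter.1 hx).1 hb⟩

/-- Sections inside a ground finset: the erased `i ∈ y` part is closed under adding points of `t.erase i`. [folklore] -/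
theorem sectionG_one_insert (t : Finset α) (B : Finset (Finset α)) (hB : ∀ x ∈ B, ∀ a ∈ t, insert a x ∈ B) (i : α) :
    ∀ x ∈ (B.filter (fun y => i ∈ y)).image (fun y => y.erase i), ∀ a ∈ t.erase i,
      insert a x ∈ (B.filter (fun y => i ∈ y)).image (fun y => y.erase i) := by
  intro x hx a ha
  rw [mem_image] at hx ⊢
  obtain ⟨y, hy, rfl⟩ := hx
  rw [mem_filter] at hy
  rw [mem_erase] at ha
  refine ⟨insert a y, mem_filter.2 ⟨hB y hy.1 a ha.2, mem_insert_of_mem hy.2⟩, ?_⟩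
  exact erase_insert_of_ne ha.1

/-- Sections inside a ground finset: members of the erased `i ∈ y` part lie in `t.erase i`. [folklore] -/
theorem sectionG_one_subset (t : Finset α) (B : Finset (Finset α)) (hBt : ∀ x ∈ B, x ⊆ t) (i : α) :
    ∀ x ∈ (B.filter (fun y => i ∈ y)).image (fun y => y.erase i), x ⊆ t.erase i := by
  intro x hx
  rw [mem_image] at hx
  obtain ⟨y, hy, rfl⟩ := hx
  intro b hb
  rw [mem_erase] at hb ⊢
  exact ⟨hb.1, hBt y (mem_filter.1 hy).1 hb.2⟩

/-- **Single-coordinate lemma at every level, inside a ground finset.**  Let `B ⊆ 𝒫(t)` be closed under adding points of `t` (`#t = N`), `i ∈ t`, `1 ≤ j`,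
`a = C(N−1,j−1)`, `b = C(N−1,j)`.  Then
`C(N,j)·#{y ∈ B | #y = j ∧ i ∈ y}·b ≤ #{x ⊆ t | i ∉ x ∧ x ∉ B ∧ insert i x ∈ B}·a·b + C(N,j)·#{y ∈ B | #y = j ∧ i ∉ y}·a`
(the statement of `choose_mul_card_level_mem_le` for the Boolean lattice `𝒫(t)`; needed inside the subcubes above a set). [this work; memo g31 §1.4] -/
theorem choose_mul_card_level_mem_le_ground (t : Finset α) (N : ℕ) (ht : #t = N) (B : Finset (Finset α))
    (hBt : ∀ x ∈ B, x ⊆ t) (hB : ∀ x ∈ B, ∀ a ∈ t, insert a x ∈ B) (i : α) (hi : i ∈ t) (j : ℕ) (hj : 1 ≤ j) :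
    N.choose j * #(B.filter fun y => #y = j ∧ i ∈ y) * (N - 1).choose j
      ≤ #(t.powerset.filter fun x => i ∉ x ∧ x ∉ B ∧ insert i x ∈ B) * (N - 1).choose (j - 1) * (N - 1).choose j
        + N.choose j * #(B.filter fun y => #y = j ∧ i ∉ y) * (N - 1).choose (j - 1) := by
  -- counts
  set P : ℕ → ℕ := fun l => #(B.filter fun y => #y = l ∧ i ∈ y) with hPdef
  set Nn : ℕ → ℕ := fun l => #(B.filter fun y => #y = l ∧ i ∉ y) with hNdef
  set piv := #(t.powerset.filter fun x => i ∉ x ∧ x ∉ B ∧ insert i x ∈ B) with hpivdef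
  set a := (N - 1).choose (j - 1) with hadef
  set b := (N - 1).choose j with hbdef
  have hte : #(t.erase i) = N - 1 := by rw [card_erase_of_mem hi, ht]
  have hN1 : 1 ≤ N := by rw [← ht]; exact card_pos.2 ⟨i, hi⟩
  -- Pascal
  have hpascal : N.choose j = a + b := by
    rw [hadef, hbdef]
    obtain ⟨N', hN'⟩ : ∃ N', N = N' + 1 := ⟨N - 1, by omega⟩
    obtain ⟨j', hj'⟩ : ∃ j', j = j' + 1 := ⟨j - 1, by omega⟩
    subst hN' hj'
    rw [Nat.choose_succ_succ', Nat.add_sub_cancel, Nat.add_sub_cancel]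
  -- density monotonicity of the two sections between levels `j-1` and `j`
  have hmono0 : Nn (j - 1) * b ≤ Nn j * a := by
    have h := card_level_mul_choose_le (t.erase i) (B.filter fun y => i ∉ y) (sectionG_zero_subset t B hBt i)
      (sectionG_zero_insert t B hB i) (j - 1)
    rw [hte, card_section_zero_level, card_section_zero_level, show j - 1 + 1 = j by omega] at h
    exact h
  have hmono1 : P j * b ≤ P (j + 1) * a := by
    have h := card_level_mul_choose_le (t.erase i) ((B.filter fun y => i ∈ y).image fun y => y.erase i)
      (sectionG_one_subset t B hBt i) (sectionG_one_insert t B hB i) (j - 1)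
    rw [hte, card_section_one_level, card_section_one_level, show j - 1 + 1 = j by omega] at h
    exact h
  -- pivotal edges from level `l` to `l+1`: at least `P (l+1) - N l`
  have hpiv : ∀ l : ℕ, P (l + 1) ≤ Nn l
      + #(t.powerset.filter fun x => (i ∉ x ∧ x ∉ B ∧ insert i x ∈ B) ∧ #x = l) := by
    intro l
    have hinj : Set.InjOn (fun y : Finset α => y.erase i) ↑(B.filter fun y => #y = l + 1 ∧ i ∈ y) := by
      intro y hy y' hy' h
      have hyi := (mem_filter.1 hy).2.2
      have hy'i := (mem_filter.1 hy').2.2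
      simp only at h
      rw [← insert_erase hyi, ← insert_erase hy'i, h]
    have himg : (B.filter fun y => #y = l + 1 ∧ i ∈ y).image (fun y => y.erase i)
        ⊆ (B.filter fun x => #x = l ∧ i ∉ x) ∪
          (t.powerset.filter fun x => (i ∉ x ∧ x ∉ B ∧ insert i x ∈ B) ∧ #x = l) := by
      intro x hx
      rw [mem_image] at hx
      obtain ⟨y, hy, rfl⟩ := hx
      rw [mem_filter] at hy
      obtain ⟨hyB, hyl, hyi⟩ := hy
      have hcard : #(y.erase i) = l := by rw [card_erase_of_mem hyi, hyl]; rfl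
      have hins : insert i (y.erase i) ∈ B := by rw [insert_erase hyi]; exact hyB
      have hyt : y.erase i ∈ t.powerset := by
        rw [mem_powerset]; exact (erase_subset i y).trans (hBt y hyB)
      by_cases hxB : y.erase i ∈ B
      · exact mem_union_left _ (mem_filter.2 ⟨hxB, hcard, notMem_erase i y⟩)
      · exact mem_union_right _ (mem_filter.2 ⟨hyt, ⟨notMem_erase i y, hxB, hins⟩, hcard⟩)
    calc P (l + 1) = #((B.filter fun y => #y = l + 1 ∧ i ∈ y).image fun y => y.erase i) :=
          (card_image_of_injOn hinj).symm
      _ ≤ #((B.filter fun x => #x = l ∧ i ∉ x) ∪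
          (t.powerset.filter fun x => (i ∉ x ∧ x ∉ B ∧ insert i x ∈ B) ∧ #x = l)) := card_le_card himg
      _ ≤ Nn l + #(t.powerset.filter fun x => (i ∉ x ∧ x ∉ B ∧ insert i x ∈ B) ∧ #x = l) :=
          card_union_le _ _
  -- the two pivotal layers are disjoint parts of the pivotal set
  have hsum : #(t.powerset.filter fun x => (i ∉ x ∧ x ∉ B ∧ insert i x ∈ B) ∧ #x = j - 1)
      + #(t.powerset.filter fun x => (i ∉ x ∧ x ∉ B ∧ insert i x ∈ B) ∧ #x = j) ≤ piv := by
    have hdisj : Disjoint (t.powerset.filter fun x => (i ∉ x ∧ x ∉ B ∧ insert i x ∈ B) ∧ #x = j - 1)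
        (t.powerset.filter fun x => (i ∉ x ∧ x ∉ B ∧ insert i x ∈ B) ∧ #x = j) := by
      rw [disjoint_filter]
      intro x _ h1 h2
      omega
    rw [← card_union_of_disjoint hdisj]
    refine card_le_card (union_subset ?_ ?_) <;>
      · intro x hx
        rw [mem_filter] at hx ⊢
        exact ⟨hx.1, hx.2.1⟩
  have h1 := hpiv (j - 1)
  rw [show j - 1 + 1 = j by omega] at h1
  have h2 := hpiv j
  have h3 : P j + P (j + 1) ≤ piv + Nn (j - 1) + Nn j := by omega
  have e1 := Nat.mul_le_mul_right a hmono0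
  have e2 := Nat.mul_le_mul_right b hmono1
  have e3 := Nat.mul_le_mul_right (a * b) h3
  show N.choose j * P j * b ≤ piv * a * b + N.choose j * Nn j * a
  rw [hpascal]
  nlinarith [e1, e2, e3]

end Summit.CriticalPhenomena.PercolationContinuityZ3.Theorems.AntiBandLevelSCL
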